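import Mathlib
import HarnessLib
import Summits.CriticalPhenomena.Ising3DConformalLimit.Theses.LocalisationClock

/-!
# Birth skeleton (BC3) for crux `TargetOfClock` — item stmt-CriticalPhenomena-15884 of route
# `LocalisationClock` (sub-problem `Ising3DConformalLimit`)

Crux BY NAME: `Summit.CriticalPhenomena.Ising3DConformalLimit.Theses.LocalisationClock.TargetOfClock`
`= LocalisationGHS → ImryMaWindowNoise → Target` ("the clock reading": the two cruxes of the route
give the positive floor of the block coupling `g_L = (3⟨M_L²⟩² − ⟨M_L⁴⟩)/⟨M_L²⟩²` of the critical
`+` state on `ℤ³`).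

## The line (the route's own three-step proof, cut along its three genuine lemmas)

Vocabulary (§0, all over EXISTING declarations; the abbreviations are literally the `let`s of the
route decl `ImryMaWindowNoise`, see `imryMaWindowNoise_iff`/`target_iff`, both `Iff.rfl`):
`wL L` = the law of the critical `+` state (`plusExpect 3 (criticalBeta 3) 0`) on configurations of
`box 3 L`; `tiltL`/`mL`/`AfL`/`rL` = posterior expectation / block polarisation `m(y) = E_y M_L` /
posterior covariances `Cov_y(σ_x, M_L)` / clock rate `r(y) = Σ_x Cov_y(σ_x,M_L)²` under the tilt
`e^{⟨y,τ⟩}`; `PL L s Φ` = planted expectation `E Φ(sτ + √s Z)` at SNR `s`; `phiL L s = E M_s²`,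
`rateL L s = E r_s`, `covL L s = Cov(r_s, M_s²)`; `sigma2 L = ⟨M_L²⟩⁺_{β_c}`, `M4 L = ⟨M_L⁴⟩⁺_{β_c}`.

* `stub_plusClockSign` (M–L; provable now; `LocalisationGHS` load-bearing): the boundary-condition
  passage of step (2) of the item text — `LocalisationGHS` (finite ferromagnets `PairIsing.gibbsAvg`,
  any observed block) ⇒ `Cov(r_s, M_s²) ≤ 0` for the block law `w_L` of the INFINITE-VOLUME critical
  `+` state, every `L`, every `s ≥ 0`. Mechanism: apply `LocalisationGHS` to the free zero-field boxes
  `Λ' = box 3 L' ⊇ box 3 L` with `c = β_c/2 · 𝟙{a ∼ b}` (reindexed `Fin |Λ'| ≃ Λ'`) and block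
  `e = 𝟙_{box 3 L}`: its functional is EXACTLY the clock covariance of the `box 3 L`-marginal of
  `μ^free_{Λ'}` (the tilt is supported on the block; the Gaussian coordinates off the block integrate
  out); that marginal converges to `w_L` as `L' → ∞` (local observables are finite combinations of
  `σ_A`: `hasBoxLimit_isingCorr_free_holds`, and free state = `+` state at `β_c(3)` by
  `hasUniqueGibbsMeasure_criticalBeta_holds` / `plusPair_eq_freePair`-type identities); the functional
  is continuous in the finite law (ratios of finite sums with positive denominators, Gaussian integrals
  of bounded continuous integrands — dominated convergence). Why it might fail: only through a
  normalisation slip (ordered-pair couplings `c a b + c b a`, the `0`-off-block convention of the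
  fields) — the statement is the weakest form the composition needs.
* `stub_plusClockIdentity` (L; THE HARDEST STUB infrastructurally; provable now): the dictionary
  (support item `ClockIdentity`, stmt-15885, = card P1) transported to `w_L` with `f = 𝟙`:
  (i) the clock `∫_{s₁}^{s₂} E r_s ds = E M_{s₂}² − E M_{s₁}²` (I-MMSE / de Bruijn:
  `d/ds E Σ_s = −E Σ_s²` for the Gaussian channel, Guo–Shamai–Verdú 2005 Thm 2 in matrix form),
  (ii) `Cov(r_s,M_s²)` integrable on `(0,∞)` (bounded by `2|Λ_L|² E r_s`, whose integral is `σ_L²`),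
  (iii) `6∫₀^∞ Cov(r_s, M_s²) ds = ⟨M_L⁴⟩⁺ − 3(⟨M_L²⟩⁺)²` — two lines of Itô for the bounded martingale
  `M_s` (`d M⁴ = 4M³ dM + 6 M² r ds`, `(E M_s²)' = E r_s`) plus `⟨M_L⟩⁺_{β_c} = 0`
  (`spontaneousMagnetization_criticalBeta_eq_zero_holds`, `plusExpect_spinAt_eq_spontaneousMagnetization_holds`:
  the general identity carries `+ 2⟨M_L⟩⁴`) and the moment identification `Σ_τ w_L(τ)(Σ_x τ_x)^k =
  ⟨M_L^k⟩⁺` (linearity of the box limit on local observables, `hasBoxLimit_isingCorr_plus_holds`).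
  Why it might fail: it does not mathematically (exact finite-dimensional Gaussian calculus, checked
  numerically to 1% by the route's card on 12 + 23 systems); the risk is Lean infrastructure (Itô is
  absent from Mathlib — use heat-equation differentiation under the finite-dimensional Gaussian
  integral instead).
* `stub_plusClockEnvelope` (M; provable now): the critical clock runs from `0` to `σ_L²`:
  `σ_L² > 0` (Griffiths), `E M_0² = ⟨M_L⟩² = 0` (symmetric phase at `β_c(3)`: ADS 2015, in tree),
  `s ↦ E M_s²` continuous on `[0,∞)` and `→ σ_L²` as `s → ∞` (posterior concentration: the likelihood
  ratio of `τ' ≠ τ` is `e^{−2s d_H(τ,τ') + O(√s)}`), `E r_s ≥ 0` and continuous. Why it might fail: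
  it does not; the content is dominated convergence over a finite configuration space.
* Composition `TargetOfClock_of` (sorry-free, below; hypotheses = the three registered stubs by
  name): monotonicity of `E M_s²` from (i) + `E r ≥ 0`; the window `[s₁,s₂]` with
  `E M_{s₁}² = aσ_L²`, `E M_{s₂}² = bσ_L²` by the intermediate value theorem; on it
  `Cov ≤ −c·E r·E M² ≤ −c a σ_L² E r_s` (ImryMaWindowNoise); off it `Cov ≤ 0` (stub A), so
  `6∫₀^∞ Cov ≤ 6∫_{s₁}^{s₂} Cov ≤ −6 c a σ_L² (b−a) σ_L²`, i.e. `⟨M⁴⟩ − 3⟨M²⟩² ≤ −6ca(b−a)σ_L⁴` (iii),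
  hence `g_L ≥ 6ca(b−a) > 0` for `L ≥ L₀`: `Target` with `c' = 6ca(b−a)`.

## Disproof used
No `Cruxes/TargetOfClock/Disproof.lean` exists (first workfile of this crux); `ledger negatives
--problem CriticalPhenomena` (11 entries, 2026-08-17): none in this sub-problem, none resembling a stub.
The two hypotheses of the crux are USED: `LocalisationGHS` at `stub_plusClockSign`, `ImryMaWindowNoise`
in the composition (window step) — no stub restates the crux, `Target`, or the summit.

References: R. Eldan, D. Mikulincer, A. Zhai, arXiv:1806.09087 §1–2 (martingale embedding, `Γ_t`);
D. Guo, S. Shamai, S. Verdú, IEEE TIT 51 (2005) = arXiv:cs/0412108, Thm 1–2 (I-MMSE);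
A. El Alaoui, A. Montanari, arXiv:2109.00709 §2 (the planted Gaussian channel / stochastic localisation);
R. Bauerschmidt, T. Bodineau, B. Dagallier, arXiv:2307.07619 §4.5, §6.3 (Polchinski = localisation flow);
M. Aizenman, H. Duminil-Copin, V. Sidoravicius, CMP 334 (2015) Thm 1.2 / Cor. 1.5 (`m*(β_c)=0`,
uniqueness at `β_c`, in tree: `MagnetizationContinuity`, `CriticalGibbsUniqueness`);
S. Friedli, Y. Velenik (CUP 2017) Thm 3.17, Ex. 3.16 (box limits, in tree: `GKSInequalities`).
-/

noncomputable section

namespace Summit.CriticalPhenomena.Ising3DConformalLimit.Cruxes.TargetOfClock.Birth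

open scoped BigOperators Topology Manifold Classical MeasureTheory ProbabilityTheory Matrix InnerProductSpace ComplexConjugate ContinuousMap
open Filter Set Function TopologicalSpace MeasureTheory
open Literature.Probability.LatticeModels
open Summit.CriticalPhenomena.Ising3DConformalLimit.Theses.LocalisationClock
  (Target LocalisationGHS ImryMaWindowNoise TargetOfClock)

/-! ## §0 The clock functionals of the critical block law (verbatim the `let`s of `ImryMaWindowNoise`) -/

/-- The law `w_L(τ) = ⟨𝟙{σ|_{Λ_L} = τ}⟩⁺_{β_c(3),0}` of the critical `+` state on configurations of
the box `Λ_L = box 3 L` (the `let w` of `ImryMaWindowNoise`). [cite: FriedliVelenik2017, Thm 3.17] -/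
def wL (L : ℕ) (τ : ↥(box 3 L) → ℤˣ) : ℝ :=
  plusExpect 3 (criticalBeta 3) 0 (fun σ => if (∀ x : ↥(box 3 L), σ x = τ x) then 1 else 0)

/-- Posterior (tilted) expectation `⟨g e^{⟨y,τ⟩}⟩_{w_L} / ⟨e^{⟨y,τ⟩}⟩_{w_L}` (the `let tilt`).
[cite: arXiv:2109.00709, §2] -/
def tiltL (L : ℕ) (y : ↥(box 3 L) → ℝ) (g : (↥(box 3 L) → ℤˣ) → ℝ) : ℝ :=
  (∑ τ, wL L τ * g τ * Real.exp (∑ x, y x * ((τ x : ℤ) : ℝ))) /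
    (∑ τ, wL L τ * Real.exp (∑ x, y x * ((τ x : ℤ) : ℝ)))

/-- Posterior block polarisation `m(y) = E_y M_L` (the `let m`). [cite: arXiv:1806.09087, §1] -/
def mL (L : ℕ) (y : ↥(box 3 L) → ℝ) : ℝ := tiltL L y (fun τ => ∑ x, ((τ x : ℤ) : ℝ))

/-- Posterior covariance `Cov_y(σ_x, M_L)` (the `let Af`). [cite: arXiv:1806.09087, §1] -/
def AfL (L : ℕ) (y : ↥(box 3 L) → ℝ) (x : ↥(box 3 L)) : ℝ :=
  tiltL L y (fun τ => ((τ x : ℤ) : ℝ) * ∑ x', ((τ x' : ℤ) : ℝ)) - tiltL L y (fun τ => ((τ x : ℤ) : ℝ)) * mL L y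

/-- The clock rate `r(y) = Σ_x Cov_y(σ_x, M_L)²` (the `let r`). [cite: arXiv:1806.09087, §1 (Γ_t)] -/
def rL (L : ℕ) (y : ↥(box 3 L) → ℝ) : ℝ := ∑ x, AfL L y x ^ 2

/-- Planted expectation at SNR `s`: `E Φ(sτ + √s Z)`, `τ ∼ w_L`, `Z` standard Gaussian on the box
(the `let P`). [cite: arXiv:2109.00709, §2] -/
def PL (L : ℕ) (s : ℝ) (Φ : (↥(box 3 L) → ℝ) → ℝ) : ℝ :=
  ∑ τ, wL L τ * ∫ z, Φ (fun x => s * ((τ x : ℤ) : ℝ) + Real.sqrt s * z x)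
    ∂(Measure.pi fun _ : ↥(box 3 L) => ProbabilityTheory.gaussianReal 0 1)

/-- `σ_L² = ⟨M_L²⟩⁺_{β_c(3),0}` (the `let σ2`; verbatim the denominator of `Target`).
[cite: AizenmanDuminilCopinSidoravicius2015, §1] -/
def sigma2 (L : ℕ) : ℝ :=
  plusExpect 3 (criticalBeta 3) 0 (fun σ => (∑ x ∈ box 3 L, spinAt x σ) ^ 2)

/-- `⟨M_L⁴⟩⁺_{β_c(3),0}` (verbatim the fourth moment in `Target`). [cite: AizenmanDuminilCopinSidoravicius2015, §1] -/
def M4 (L : ℕ) : ℝ :=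
  plusExpect 3 (criticalBeta 3) 0 (fun σ => (∑ x ∈ box 3 L, spinAt x σ) ^ 4)

/-- `φ_L(s) = E M_s²`, the expected squared posterior block polarisation. [cite: arXiv:1806.09087, §1] -/
def phiL (L : ℕ) (s : ℝ) : ℝ := PL L s (fun y => mL L y ^ 2)

/-- `E r_s`, the expected clock rate. [cite: arXiv:1806.09087, §1] -/
def rateL (L : ℕ) (s : ℝ) : ℝ := PL L s (rL L)

/-- `Cov(r_s, M_s²)` under the planted law at SNR `s` (the left side of `ImryMaWindowNoise`).
[cite: arXiv:1806.09087, §1] -/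
def covL (L : ℕ) (s : ℝ) : ℝ := PL L s (fun y => rL L y * mL L y ^ 2) - rateL L s * phiL L s

/-- `ImryMaWindowNoise` read through the abbreviations (definitional: `Iff.rfl`). [folklore] -/
theorem imryMaWindowNoise_iff :
    ImryMaWindowNoise ↔
      ∃ a b c : ℝ, 0 < a ∧ a < b ∧ b < 1 ∧ 0 < c ∧ ∃ L₀ : ℕ, ∀ L ≥ L₀, ∀ s : ℝ, 0 ≤ s →
        a * sigma2 L ≤ phiL L s → phiL L s ≤ b * sigma2 L →
          covL L s ≤ -(c * (rateL L s * phiL L s)) :=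
  Iff.rfl

/-- `Target` read through the abbreviations (definitional: `Iff.rfl`). [folklore] -/
theorem target_iff :
    Target ↔ ∃ c : ℝ, 0 < c ∧ ∃ L₀ : ℕ, ∀ L ≥ L₀, c ≤ (3 * sigma2 L ^ 2 - M4 L) / sigma2 L ^ 2 :=
  Iff.rfl

/-! ## §1 The stub statements (named `Prop`s over the §0 functionals) -/

/-- **PLUS-STATE CLOCK SIGN (b.c. passage).** `LocalisationGHS` (SL-GHS for finite ferromagnets
observed on a block) implies `Cov(r_s, M_s²) ≤ 0` for the block law `w_L` of the infinite-volume
critical `+` state on `ℤ³`, for every box `L` and every SNR `s ≥ 0`: apply it to free zero-field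
boxes `Λ' ⊇ Λ_L` with `c = (β_c/2)𝟙{a∼b}`, block `e = Λ_L` (its functional is exactly the clock
covariance of the `Λ_L`-marginal of `μ^free_{Λ'}`), let `Λ' ↑ ℤ³` (free state = `+` state at
`β_c(3)`, ADS 2015 Thm 1.2; local box limits, Friedli–Velenik Ex. 3.16) and use continuity of the
functional in the finite law. [cite: AizenmanDuminilCopinSidoravicius2015, Thm 1.2]
[cite: FriedliVelenik2017, Exercise 3.16 and Thm 3.17] -/
def PlusClockSign : Prop :=
  LocalisationGHS → ∀ (L : ℕ) (s : ℝ), 0 ≤ s → covL L s ≤ 0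

/-- **PLUS-STATE CLOCK IDENTITY (the dictionary for `w_L`, `f = 𝟙`).** For every `L`:
(i) the clock `∫_{s₁}^{s₂} E r_s ds = E M_{s₂}² − E M_{s₁}²` (`0 ≤ s₁ ≤ s₂`; I-MMSE/de Bruijn),
(ii) `s ↦ Cov(r_s, M_s²)` is integrable on `(0,∞)`, (iii) `6∫₀^∞ Cov(r_s,M_s²) ds = ⟨M_L⁴⟩⁺ − 3(⟨M_L²⟩⁺)²`
(Itô for the bounded martingale `M_s`, `⟨M_L⟩⁺_{β_c} = 0`, and `Σ_τ w_L(τ)(Σ_xτ_x)^k = ⟨M_L^k⟩⁺`).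
Support item `ClockIdentity` (stmt-15885) specialised and transported to the critical block law.
[cite: arXiv:1806.09087, §1–2] [cite: arXiv:cs/0412108, Thm 2] [cite: AizenmanDuminilCopinSidoravicius2015, Cor. 1.5] -/
def PlusClockIdentity : Prop :=
  ∀ L : ℕ,
    (∀ s₁ s₂ : ℝ, 0 ≤ s₁ → s₁ ≤ s₂ → ∫ s in s₁..s₂, rateL L s = phiL L s₂ - phiL L s₁) ∧
    IntegrableOn (covL L) (Set.Ioi 0) ∧
    6 * ∫ s in Set.Ioi 0, covL L s = M4 L - 3 * sigma2 L ^ 2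

/-- **CRITICAL CLOCK ENVELOPE (the clock runs from `0` to `σ_L²`).** For every `L`: `σ_L² > 0`
(Griffiths); `E M_0² = 0` (`= ⟨M_L⟩²`, symmetric phase at `β_c(3)`); `s ↦ E M_s²` is continuous on
`[0,∞)` and tends to `σ_L²` as `s → ∞` (posterior concentration); `E r_s ≥ 0` and `s ↦ E r_s` is
continuous on `[0,∞)` (dominated convergence on a finite configuration space).
[cite: AizenmanDuminilCopinSidoravicius2015, Thm 1.2 / Cor. 1.5] [cite: FriedliVelenik2017, Thm 3.17 and §3.6] -/
def PlusClockEnvelope : Prop :=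
  ∀ L : ℕ,
    0 < sigma2 L ∧ phiL L 0 = 0 ∧ ContinuousOn (phiL L) (Set.Ici 0) ∧
      Tendsto (phiL L) atTop (𝓝 (sigma2 L)) ∧
      (∀ s : ℝ, 0 ≤ s → 0 ≤ rateL L s) ∧ ContinuousOn (rateL L) (Set.Ici 0)

/-! ## §2 Registered stubs -/

/-- stub A (M–L, provable now; uses the crux hypothesis `LocalisationGHS`): the b.c. passage.
[cite: AizenmanDuminilCopinSidoravicius2015, Thm 1.2] -/
theorem stub_plusClockSign : PlusClockSign := by
  sorry

/-- stub B (L, hardest — Gaussian/Itô calculus in Lean; provable now): the clock identity for `w_L`.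
[cite: arXiv:1806.09087, §1–2] -/
theorem stub_plusClockIdentity : PlusClockIdentity := by
  sorry

/-- stub C (M, provable now): the critical clock envelope. [cite: AizenmanDuminilCopinSidoravicius2015, Cor. 1.5] -/
theorem stub_plusClockEnvelope : PlusClockEnvelope := by
  sorry

/-! ### Name-keyed aliases of the stub statements (hypotheses of the composition) -/
namespace Registered

/-- Alias of `PlusClockSign` keyed by the registered stub name. [folklore] -/
abbrev stub_plusClockSign : Prop := PlusClockSign
/-- Alias of `PlusClockIdentity` keyed by the registered stub name. [folklore] -/
abbrev stub_plusClockIdentity : Prop := PlusClockIdentity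
/-- Alias of `PlusClockEnvelope` keyed by the registered stub name. [folklore] -/
abbrev stub_plusClockEnvelope : Prop := PlusClockEnvelope

end Registered

/-! ## §3 Composition — the crux BY NAME from the three stub statements (sorry-free) -/

/-- **The clock reading (composition, sorry-free).** `PlusClockSign → PlusClockIdentity →
PlusClockEnvelope → TargetOfClock`: given `LocalisationGHS` and `ImryMaWindowNoise (a,b,c,L₀)`, for
`L ≥ L₀` the window `[s₁,s₂]` with `E M_{s₁}² = aσ_L²`, `E M_{s₂}² = bσ_L²` exists (IVT on the
continuous nondecreasing clock `0 → σ_L²`), on it `Cov ≤ −c a σ_L² E r_s`, off it `Cov ≤ 0`, whence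
`⟨M⁴⟩ − 3⟨M²⟩² = 6∫₀^∞ Cov ≤ −6ca(b−a)σ_L⁴` and `g_L ≥ 6ca(b−a) > 0`. Axiom closure:
propext, Classical.choice, Quot.sound. [cite: arXiv:1806.09087, §1] [cite: AizenmanDuminilCopinSidoravicius2015, §1] -/
theorem TargetOfClock_of (hA : Registered.stub_plusClockSign) (hB : Registered.stub_plusClockIdentity)
    (hC : Registered.stub_plusClockEnvelope) : TargetOfClock := by
  show LocalisationGHS → ImryMaWindowNoise → Target
  intro hGHS hIM
  obtain ⟨a, b, c, ha, hab, hb1, hc, L₀, hwin⟩ := imryMaWindowNoise_iff.mp hIM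
  have hsign : ∀ (L : ℕ) (s : ℝ), 0 ≤ s → covL L s ≤ 0 := hA hGHS
  have hba : 0 < b - a := sub_pos.mpr hab
  refine target_iff.mpr ⟨6 * c * a * (b - a), ?_, L₀, fun L hL => ?_⟩
  · exact mul_pos (mul_pos (mul_pos (by norm_num) hc) ha) hba
  obtain ⟨hσ, hφ0, hφc, hφlim, hr0, hrc⟩ := hC L
  obtain ⟨hclock, hint, hκ⟩ := hB L
  -- the clock is nondecreasing on `[0, ∞)`: `φ(s₂) - φ(s₁) = ∫ E r ≥ 0`
  have hmono : ∀ s₁ s₂ : ℝ, 0 ≤ s₁ → s₁ ≤ s₂ → phiL L s₁ ≤ phiL L s₂ := by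
    intro s₁ s₂ h₁ h₁₂
    have h := hclock s₁ s₂ h₁ h₁₂
    have hnn : 0 ≤ ∫ s in s₁..s₂, rateL L s :=
      intervalIntegral.integral_nonneg h₁₂ (fun u hu => hr0 u (h₁.trans hu.1))
    linarith
  -- a time `S ≥ 0` at which the clock has passed `b σ_L²`
  have hbσ : b * sigma2 L < sigma2 L := by
    have h := mul_lt_mul_of_pos_right hb1 hσ
    rwa [one_mul] at h
  have haσb : a * sigma2 L < b * sigma2 L := mul_lt_mul_of_pos_right hab hσ
  obtain ⟨S, hS0, hS⟩ : ∃ S : ℝ, 0 ≤ S ∧ b * sigma2 L < phiL L S := by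
    have hev : ∀ᶠ s in atTop, b * sigma2 L < phiL L s := hφlim.eventually (lt_mem_nhds hbσ)
    obtain ⟨S, hS⟩ := ((eventually_ge_atTop (0 : ℝ)).and hev).exists
    exact ⟨S, hS.1, hS.2⟩
  -- the window endpoints by the intermediate value theorem
  have hcontS : ContinuousOn (phiL L) (Set.Icc 0 S) := hφc.mono Set.Icc_subset_Ici_self
  have haσ_mem : a * sigma2 L ∈ Set.Icc (phiL L 0) (phiL L S) := by
    rw [hφ0]
    exact ⟨(mul_pos ha hσ).le, by linarith⟩
  have hbσ_mem : b * sigma2 L ∈ Set.Icc (phiL L 0) (phiL L S) := by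
    rw [hφ0]
    exact ⟨by linarith [(mul_pos ha hσ).le], hS.le⟩
  obtain ⟨s₁, hs₁, hφ₁⟩ := intermediate_value_Icc hS0 hcontS haσ_mem
  obtain ⟨s₂, hs₂, hφ₂⟩ := intermediate_value_Icc hS0 hcontS hbσ_mem
  have h12 : s₁ ≤ s₂ := by
    by_contra h
    have h' := hmono s₂ s₁ hs₂.1 (not_le.mp h).le
    rw [hφ₁, hφ₂] at h'
    linarith
  -- on the window: order-one anti-correlation (ImryMaWindowNoise), `Cov ≤ -(c a σ_L²)·E r_s`
  have hwin' : ∀ s ∈ Set.Ioc s₁ s₂, covL L s ≤ -(c * a * sigma2 L) * rateL L s := by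
    intro s hs
    have hs0 : 0 ≤ s := hs₁.1.trans hs.1.le
    have hlo : a * sigma2 L ≤ phiL L s := by
      rw [← hφ₁]; exact hmono s₁ s hs₁.1 hs.1.le
    have hhi : phiL L s ≤ b * sigma2 L := by
      rw [← hφ₂]; exact hmono s s₂ hs0 hs.2
    have h := hwin L hL s hs0 hlo hhi
    have hr := hr0 s hs0
    have key : c * a * sigma2 L * rateL L s ≤ c * (rateL L s * phiL L s) := by
      have h1 : rateL L s * (a * sigma2 L) ≤ rateL L s * phiL L s :=
        mul_le_mul_of_nonneg_left hlo hr
      have h2 := mul_le_mul_of_nonneg_left h1 hc.le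
      calc c * a * sigma2 L * rateL L s = c * (rateL L s * (a * sigma2 L)) := by ring
        _ ≤ c * (rateL L s * phiL L s) := h2
    have hre : -(c * a * sigma2 L) * rateL L s = -(c * a * sigma2 L * rateL L s) := by ring
    rw [hre]
    linarith
  -- integrate over the window
  have hIcc_rate : IntegrableOn (rateL L) (Set.Icc s₁ s₂) :=
    (hrc.mono (fun s hs => (hs₁.1.trans hs.1 : (0 : ℝ) ≤ s))).integrableOn_Icc
  have hIoc_rate : IntegrableOn (rateL L) (Set.Ioc s₁ s₂) := hIcc_rate.mono_set Set.Ioc_subset_Icc_self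
  have hsub : Set.Ioc s₁ s₂ ⊆ Set.Ioi (0 : ℝ) := fun s hs => (hs₁.1.trans_lt hs.1 : (0 : ℝ) < s)
  have hIoc_cov : IntegrableOn (covL L) (Set.Ioc s₁ s₂) := hint.mono_set hsub
  have hwindow :
      ∫ s in Set.Ioc s₁ s₂, covL L s ≤ -(c * a * sigma2 L) * ((b - a) * sigma2 L) := by
    calc ∫ s in Set.Ioc s₁ s₂, covL L s
        ≤ ∫ s in Set.Ioc s₁ s₂, -(c * a * sigma2 L) * rateL L s :=
          setIntegral_mono_on hIoc_cov (hIoc_rate.integrable.const_mul _) measurableSet_Ioc hwin'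
      _ = -(c * a * sigma2 L) * ∫ s in Set.Ioc s₁ s₂, rateL L s := integral_const_mul _ _
      _ = -(c * a * sigma2 L) * (phiL L s₂ - phiL L s₁) := by
          rw [← intervalIntegral.integral_of_le h12, hclock s₁ s₂ hs₁.1 h12]
      _ = -(c * a * sigma2 L) * ((b - a) * sigma2 L) := by rw [hφ₁, hφ₂]; ring
  -- off the window `Cov ≤ 0`, so the whole integral is at most the window integral
  have hwhole : ∫ s in Set.Ioi (0 : ℝ), covL L s ≤ ∫ s in Set.Ioc s₁ s₂, covL L s := by
    have hneg : ∫ s in Set.Ioc s₁ s₂, -covL L s ≤ ∫ s in Set.Ioi (0 : ℝ), -covL L s := by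
      refine setIntegral_mono_set (f := fun s => -covL L s) hint.neg ?_ hsub.eventuallyLE
      filter_upwards [ae_restrict_mem measurableSet_Ioi] with s hs
      exact neg_nonneg.mpr (hsign L s (le_of_lt hs))
    rw [integral_neg, integral_neg] at hneg
    linarith
  -- the clock identity turns this into the floor of the block coupling
  have hfin : M4 L - 3 * sigma2 L ^ 2 ≤ -(6 * c * a * (b - a) * sigma2 L ^ 2) := by
    have h6 := hwhole.trans hwindow
    have hre : -(6 * c * a * (b - a) * sigma2 L ^ 2) = 6 * (-(c * a * sigma2 L) * ((b - a) * sigma2 L)) := by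
      ring
    rw [hre, ← hκ]
    linarith
  rw [le_div_iff₀ (by positivity)]
  linarith

/-- **`TargetOfClock_proof`** — the crux `Theses.LocalisationClock.TargetOfClock` with NO hypotheses, from
the three declared `stub_*` through the sorry-free composition `TargetOfClock_of`; closed modulo exactly
`stub_plusClockSign`, `stub_plusClockIdentity`, `stub_plusClockEnvelope`. [cite: arXiv:1806.09087, §1] -/
theorem TargetOfClock_proof : TargetOfClock :=
  TargetOfClock_of stub_plusClockSign stub_plusClockIdentity stub_plusClockEnvelope

end Summit.CriticalPhenomena.Ising3DConformalLimit.Cruxes.TargetOfClock.Birth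

end
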